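import Mathlib.NumberTheory.Padics.Hensel
import Mathlib.NumberTheory.Padics.RingHoms
import Mathlib.Algebra.Polynomial.Identities
import HarnessLib

/-!
# A `decide`-checkable ROOT CENSUS for an integer polynomial over `ℤ_p` (Hensel balls + a residue
# check): the roots of `F ∈ ℤ[X]` in `ℤ_p` are EXACTLY the Hensel lifts of a certified list of
# approximate roots (team n1011, row T-LOC3T, FILE A1 — generic in the prime `p`: the checker and
# the soundness of its residue tree search; the census theorem itself is FILE A2
# `PadicRootCensusRoots`)

HONEST FRAMING (cell `b2b-bsdres`, run/shared/lean/b2b/bsd-rank1-residual/, verbatim in every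
file): the goal of the cell is to DELETE the COMBINATION-SHAPED residual classes of the
Birch–Swinnerton-Dyer formula for ALL analytic-rank `≤ 1` elliptic curves over `ℚ` — "full BSD
formula for every rank `≤ 1` curve in class `C`" assembled STRICTLY from published theorems — so
that the rank-`≤ 1` remainder becomes exactly the CONSTRUCTION-SHAPED classes, which are TYPED
(missing-input `Prop`s), NOT attempted. This is not "finishing BSD". Team n1011 (N10/N11): research
route; this file is a TOOL (pure `p`-adic algebra); nothing is booked by it; no mark / label moved.
No named fact, no `sorry`; the only definitions are COMPUTABLE bookkeeping (a polynomial from a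
coefficient list, Horner evaluation, and the Boolean certificate checker `RootCensus.check`) so that
instances are verified by `decide`.

## What

For `F = ofList l ∈ ℤ[X]` (coefficient list `l = [c₀, c₁, …]`), a prime `p`, a precision `k` and a
certificate `cert : List (ℤ × ℕ × ℕ)` of triples `(c, m, N)` ("`c` is an approximate root with
`v_p(F′(c)) = m` exactly and `p^N ∣ F(c)`, `N ≥ 2m + 1`, `m < k`"), the checker `RootCensus.check
p l k cert` verifies, by integer arithmetic only: (R2) those valuation claims; (R3) the Hensel balls
`{z : z ≡ c (mod p^{m+1})}` are pairwise disjoint; (R1) every residue `r mod p^k` with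
`F(r) ≡ 0 (mod p^k)` lies in one of the balls. THEN (`RootCensus.exists_roots_of_check`): there are
`p`-adic integers `z₁, …, z_n` (`n = cert.length`), pairwise distinct, with `F(zᵢ) = 0`,
`‖zᵢ − cᵢ‖ ≤ p^{-(Nᵢ − mᵢ)}` (a-posteriori precision), and EVERY root of `F` in `ℤ_p` is one of
them. Ingredients: Mathlib's `hensels_lemma` (existence + uniqueness in the ball
`‖z − c‖ < ‖F′(c)‖`), `Polynomial.binomExpansion` (for `‖F(c)‖ = ‖F′(c)‖·‖z − c‖`),
`PadicInt.appr` (the residue of a root mod `p^k`) and `padic_polynomial_dist`.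

Consumer: FILE C `LocalThreeTorsionDecider` (the `ℚ₃`-rational `3`-torsion count of an elliptic
curve = `1 + 2·#{roots of Ψ₃ in ℤ₃ with a square `g`-value}`), discharging the row binder
`ht : #E(ℚ₃)[3] = 3^t` of route 1's records (r1 ROUTE-1 §27.2).

References: standard (Hensel's lemma; e.g. J. W. S. Cassels, *Local Fields*, LMSST 3 (1986), Ch. 4
§3; H. Cohen, *A Course in Computational Algebraic Number Theory*, GTM 138 (1993), §3.5.3).
-/

set_option autoImplicit false

open Polynomial

namespace Summit.BirchSwinnertonDyer.Rank1Residual.GaloisImage.RootCensus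

/-! ### Polynomials from coefficient lists, with computable (Horner) evaluation -/

/-- The integer polynomial `c₀ + c₁X + c₂X² + ⋯` with coefficient list `[c₀, c₁, c₂, …]`.
[folklore] -/
noncomputable def ofList : List ℤ → ℤ[X]
  | [] => 0
  | c :: l => C c + X * ofList l

/-- Horner evaluation of the coefficient list `l` at `x` (computable; `= (ofList l).eval x`).
[folklore] -/
def evalList : List ℤ → ℤ → ℤ
  | [], _ => 0
  | c :: l, x => c + x * evalList l x

/-- Horner evaluation of the DERIVATIVE of `ofList l` at `x` (computable;
`= (ofList l).derivative.eval x`, from `(c + X·F)′ = F + X·F′`). [folklore] -/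
def evalDerivList : List ℤ → ℤ → ℤ
  | [], _ => 0
  | _ :: l, x => evalList l x + x * evalDerivList l x

/-- `(ofList l).eval x = evalList l x`. [folklore] -/
theorem eval_ofList (l : List ℤ) (x : ℤ) : (ofList l).eval x = evalList l x := by
  induction l with
  | nil => simp [ofList, evalList]
  | cons c l ih => simp [ofList, evalList, ih]

/-- `(ofList l).derivative.eval x = evalDerivList l x`. [folklore] -/
theorem eval_derivative_ofList (l : List ℤ) (x : ℤ) :
    (ofList l).derivative.eval x = evalDerivList l x := by
  induction l with
  | nil => simp [ofList, evalDerivList]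
  | cons c l ih =>
    simp only [ofList, evalDerivList, derivative_add, derivative_C, derivative_mul, derivative_X,
      zero_add, one_mul, eval_add, eval_mul, eval_X, ih, eval_ofList]

/-- `aeval z (ofList []) = 0`. [folklore] -/
@[simp] theorem aeval_ofList_nil {A : Type*} [CommRing A] [Algebra ℤ A] (z : A) :
    aeval z (ofList []) = 0 := by simp [ofList]

/-- `aeval z (ofList (c :: l)) = c + z · aeval z (ofList l)` (Horner step). [folklore] -/
@[simp] theorem aeval_ofList_cons {A : Type*} [CommRing A] [Algebra ℤ A] (z : A) (c : ℤ)
    (l : List ℤ) : aeval z (ofList (c :: l)) = (c : A) + z * aeval z (ofList l) := by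
  simp [ofList, map_add, map_mul, aeval_X]

variable {p : ℕ} [hp : Fact p.Prime]

/-- At an integer point the `ℤ_p`-valued evaluation is the cast of the integer evaluation.
[folklore] -/
theorem aeval_intCast_ofList (l : List ℤ) (c : ℤ) :
    aeval (c : ℤ_[p]) (ofList l) = ((evalList l c : ℤ) : ℤ_[p]) := by
  have h := aeval_algebraMap_apply_eq_algebraMap_eval (A := ℤ_[p]) c (ofList l)
  rw [eval_ofList] at h
  simpa using h

/-- The `ℤ_p`-valued evaluation at `z ∈ ℤ_p`, coerced to `ℚ_p`, is the `ℚ_p`-valued evaluation.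
[folklore] -/
theorem coe_aeval_ofList (l : List ℤ) (z : ℤ_[p]) :
    ((aeval z (ofList l) : ℤ_[p]) : ℚ_[p]) = aeval (z : ℚ_[p]) (ofList l) := by
  induction l with
  | nil => simp
  | cons c l ih => simp [aeval_ofList_cons, ih]

/-- Same for the derivative. [folklore] -/
theorem aeval_intCast_derivative_ofList (l : List ℤ) (c : ℤ) :
    aeval (c : ℤ_[p]) (ofList l).derivative = ((evalDerivList l c : ℤ) : ℤ_[p]) := by
  have h := aeval_algebraMap_apply_eq_algebraMap_eval (A := ℤ_[p]) c (ofList l).derivative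
  rw [eval_derivative_ofList] at h
  simpa using h

/-! ### Norms of integers in `ℤ_p` from divisibility -/

/-- `p^n ∣ x ⟹ ‖x‖ ≤ p^{-n}` in `ℤ_p`. [folklore] -/
theorem norm_intCast_le_of_dvd {x : ℤ} {n : ℕ} (h : (p : ℤ) ^ n ∣ x) :
    ‖(x : ℤ_[p])‖ ≤ (p : ℝ) ^ (-(n : ℤ)) :=
  PadicInt.norm_int_le_pow_iff_dvd.mpr h

/-- `p^n ∣ x` and `p^{n+1} ∤ x` ⟹ `‖x‖ = p^{-n}` in `ℤ_p`. [folklore] -/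
theorem norm_intCast_eq_of_dvd_of_not_dvd {x : ℤ} {n : ℕ} (h : (p : ℤ) ^ n ∣ x)
    (h' : ¬ (p : ℤ) ^ (n + 1) ∣ x) : ‖(x : ℤ_[p])‖ = (p : ℝ) ^ (-(n : ℤ)) := by
  refine le_antisymm (norm_intCast_le_of_dvd h) (le_of_not_gt fun hlt => ?_)
  have hexp : (-((n + 1 : ℕ) : ℤ)) + 1 = -(n : ℤ) := by push_cast; ring
  have : ‖(x : ℤ_[p])‖ ≤ (p : ℝ) ^ (-((n + 1 : ℕ) : ℤ)) := by
    rw [PadicInt.norm_le_pow_iff_norm_lt_pow_add_one, hexp]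
    exact hlt
  exact h' (PadicInt.norm_int_le_pow_iff_dvd.mp this)

/-- `x % m = 0 ↔ m ∣ x` for integers (the checker works with `%`). [folklore] -/
theorem emod_eq_zero_iff_dvd' (x m : ℤ) : x % m = 0 ↔ m ∣ x :=
  ⟨Int.dvd_of_emod_eq_zero, Int.emod_eq_zero_of_dvd⟩

/-! ### The a-posteriori precision of a Hensel root -/

/-- **A-posteriori precision.** If `F(z) = 0` and `‖z − a‖ < ‖F′(a)‖` then
`‖F(a)‖ = ‖F′(a)‖ · ‖z − a‖` (Taylor expansion to second order: the quadratic remainder is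
strictly smaller than the linear term). [folklore] -/
theorem norm_aeval_eq_mul_of_root {R : Type*} [CommRing R] [Algebra R ℤ_[p]] (F : R[X])
    {a z : ℤ_[p]} (hz : aeval z F = 0) (hza : ‖z - a‖ < ‖aeval a F.derivative‖) :
    ‖aeval a F‖ = ‖aeval a F.derivative‖ * ‖z - a‖ := by
  set G : ℤ_[p][X] := F.map (algebraMap R ℤ_[p]) with hG
  have hGa : G.eval a = aeval a F := by rw [hG, eval_map_algebraMap]
  have hGz : G.eval z = aeval z F := by rw [hG, eval_map_algebraMap]
  have hG'a : G.derivative.eval a = aeval a F.derivative := by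
    rw [hG, derivative_map, eval_map_algebraMap]
  obtain ⟨κ, hκ⟩ := binomExpansion G a (z - a)
  rw [add_sub_cancel, hGz, hz, hGa, hG'a] at hκ
  -- `0 = F(a) + F'(a)(z-a) + κ (z-a)²`
  by_cases hza0 : z - a = 0
  · have hFa : aeval a F = 0 := by
      have := hκ; rw [hza0] at this; simpa using this.symm
    rw [hFa, hza0]; simp
  have hlin : ‖aeval a F.derivative * (z - a)‖ = ‖aeval a F.derivative‖ * ‖z - a‖ := norm_mul _ _
  have hquad : ‖κ * (z - a) ^ 2‖ < ‖aeval a F.derivative * (z - a)‖ := by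
    rw [hlin, norm_mul, norm_pow, pow_two, ← mul_assoc]
    have hpos : 0 < ‖z - a‖ := norm_pos_iff.mpr hza0
    refine mul_lt_mul_of_pos_right ?_ hpos
    calc ‖κ‖ * ‖z - a‖ ≤ 1 * ‖z - a‖ := by
          gcongr; exact PadicInt.norm_le_one κ
      _ = ‖z - a‖ := one_mul _
      _ < ‖aeval a F.derivative‖ := hza
  have hsum : aeval a F = -(aeval a F.derivative * (z - a) + κ * (z - a) ^ 2) := by
    linear_combination -hκ
  rw [hsum, norm_neg, PadicInt.norm_add_eq_max_of_ne (by
    intro h; rw [h] at hquad; exact lt_irrefl _ hquad), max_eq_left hquad.le, hlin]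

/-! ### The certificate checker -/

/-- Check of ONE certificate entry `(c, m, N)`: `m < k`, `2m + 1 ≤ N`, `p^m ∣ F′(c)`,
`p^{m+1} ∤ F′(c)`, `p^N ∣ F(c)` (integer arithmetic). [folklore] -/
def entryOK (p : ℕ) (l : List ℤ) (k : ℕ) (e : ℤ × ℕ × ℕ) : Bool :=
  decide (e.2.1 < k) && decide (2 * e.2.1 + 1 ≤ e.2.2) &&
    (evalDerivList l e.1 % ((p : ℤ) ^ e.2.1) == 0) &&
    !(evalDerivList l e.1 % ((p : ℤ) ^ (e.2.1 + 1)) == 0) &&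
    (evalList l e.1 % ((p : ℤ) ^ e.2.2) == 0)

/-- Disjointness of two Hensel balls: `c ≢ c′ (mod p^{min(m,m′)+1})`. [folklore] -/
def disjointOK (p : ℕ) (e e' : ℤ × ℕ × ℕ) : Bool :=
  !((e.1 - e'.1) % ((p : ℤ) ^ (min e.2.1 e'.2.1 + 1)) == 0)

/-- Pairwise disjointness of the balls of a certificate. [folklore] -/
def pairwiseOK (p : ℕ) : List (ℤ × ℕ × ℕ) → Bool
  | [] => true
  | e :: es => es.all (disjointOK p e) && pairwiseOK p es

/-- Is the residue `r` inside a certified Hensel ball of level `≤ j` (`r ≡ c (mod p^{m+1})` with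
`m + 1 ≤ j`)? [folklore] -/
def inBall (p : ℕ) (cert : List (ℤ × ℕ × ℕ)) (j : ℕ) (r : ℤ) : Bool :=
  cert.any fun e => decide (e.2.1 + 1 ≤ j) && ((r - e.1) % ((p : ℤ) ^ (e.2.1 + 1)) == 0)

/-- A residue `r (mod p^j)` is ALIVE if `F(r) ≡ 0 (mod p^j)` and it is in no certified ball of
level `≤ j` (only alive residues can still hide an uncertified root). [folklore] -/
def alive (p : ℕ) (l : List ℤ) (cert : List (ℤ × ℕ × ℕ)) (j : ℕ) (r : ℤ) : Bool :=
  (evalList l r % ((p : ℤ) ^ j) == 0) && !(inBall p cert j r)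

/-- One level of the residue tree: the alive children `r + t p^j (mod p^{j+1})`, `t < p`, of the
alive residues `r (mod p^j)`. [folklore] -/
def frontierStep (p : ℕ) (l : List ℤ) (cert : List (ℤ × ℕ × ℕ)) (j : ℕ) (fr : List ℤ) :
    List ℤ :=
  fr.flatMap fun r =>
    ((List.range p).map fun t : ℕ => r + (t : ℤ) * (p : ℤ) ^ j).filter (alive p l cert (j + 1))

/-- The residue check (R1) as a TREE SEARCH with `fuel` levels from level `j` and frontier `fr`:
succeeds iff the alive frontier dies out. (Only alive residues are expanded, so the cost is
proportional to the number of near-roots, not to `p^k`.) [folklore] -/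
def coverTree (p : ℕ) (l : List ℤ) (cert : List (ℤ × ℕ × ℕ)) : ℕ → ℕ → List ℤ → Bool
  | 0, _, fr => fr.isEmpty
  | fuel + 1, j, fr => fr.isEmpty || coverTree p l cert fuel (j + 1) (frontierStep p l cert j fr)

/-- The residue check (R1): within `k` levels every residue class that could contain a root is
absorbed by a certified ball. [folklore] -/
def coverOK (p : ℕ) (l : List ℤ) (k : ℕ) (cert : List (ℤ × ℕ × ℕ)) : Bool :=
  coverTree p l cert k 0 [0]

/-- **The root-census checker** (all three conditions). [folklore] -/
def check (p : ℕ) (l : List ℤ) (k : ℕ) (cert : List (ℤ × ℕ × ℕ)) : Bool :=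
  cert.all (entryOK p l k) && pairwiseOK p cert && coverOK p l k cert

/-! ### Unpacking the checker -/

section Unpack

variable {l : List ℤ} {k : ℕ} {cert : List (ℤ × ℕ × ℕ)}

omit hp in
/-- What `entryOK` certifies, as propositions. [folklore] -/
theorem entryOK_spec {e : ℤ × ℕ × ℕ} (h : entryOK p l k e = true) :
    e.2.1 < k ∧ 2 * e.2.1 + 1 ≤ e.2.2 ∧ (p : ℤ) ^ e.2.1 ∣ evalDerivList l e.1 ∧
      ¬ (p : ℤ) ^ (e.2.1 + 1) ∣ evalDerivList l e.1 ∧ (p : ℤ) ^ e.2.2 ∣ evalList l e.1 := by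
  simp only [entryOK, Bool.and_eq_true, decide_eq_true_eq, beq_iff_eq, Bool.not_eq_true',
    beq_eq_false_iff_ne, ne_eq, emod_eq_zero_iff_dvd'] at h
  exact ⟨h.1.1.1.1, h.1.1.1.2, h.1.1.2, h.1.2, h.2⟩

omit hp in
/-- What `pairwiseOK` certifies: the list is pairwise ball-disjoint. [folklore] -/
theorem pairwise_of_pairwiseOK (h : pairwiseOK p cert = true) :
    cert.Pairwise fun e e' => ¬ (p : ℤ) ^ (min e.2.1 e'.2.1 + 1) ∣ e.1 - e'.1 := by
  induction cert with
  | nil => exact List.Pairwise.nil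
  | cons e es ih =>
    simp only [pairwiseOK, Bool.and_eq_true, List.all_eq_true] at h
    refine List.Pairwise.cons ?_ (ih h.2)
    intro e' he'
    have := h.1 e' he'
    simpa [disjointOK, emod_eq_zero_iff_dvd'] using this

/-- A root `z ∈ ℤ_p` lies in the certified ball of the entry `e = (c, m, N)`:
`‖z - c‖ ≤ p^{-(m+1)}`. -/
private def InBallOf (z : ℤ_[p]) (e : ℤ × ℕ × ℕ) : Prop :=
  ‖z - (e.1 : ℤ_[p])‖ ≤ (p : ℝ) ^ (-((e.2.1 + 1 : ℕ) : ℤ))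

/-- Digit extraction: if `z ≡ r (mod p^j)` then `z ≡ r + t p^j (mod p^{j+1})` for some `t < p`.
[folklore] -/
theorem exists_digit {z : ℤ_[p]} {r : ℤ} {j : ℕ} (h : ‖z - (r : ℤ_[p])‖ ≤ (p : ℝ) ^ (-(j : ℤ))) :
    ∃ t : ℕ, t < p ∧
      ‖z - ((r + (t : ℤ) * (p : ℤ) ^ j : ℤ) : ℤ_[p])‖ ≤ (p : ℝ) ^ (-((j + 1 : ℕ) : ℤ)) := by
  rw [PadicInt.norm_le_pow_iff_mem_span_pow, Ideal.mem_span_singleton'] at h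
  obtain ⟨w, hw⟩ := h
  refine ⟨w.appr 1, by simpa using w.appr_lt 1, ?_⟩
  rw [PadicInt.norm_le_pow_iff_mem_span_pow]
  have hspec := PadicInt.appr_spec 1 w
  rw [Ideal.mem_span_singleton'] at hspec ⊢
  obtain ⟨u, hu⟩ := hspec
  refine ⟨u, ?_⟩
  have : (((r + ((w.appr 1 : ℕ) : ℤ) * (p : ℤ) ^ j : ℤ)) : ℤ_[p]) =
      (r : ℤ_[p]) + ((w.appr 1 : ℕ) : ℤ_[p]) * (p : ℤ_[p]) ^ j := by push_cast; ring
  rw [this, pow_one] at *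
  linear_combination (p : ℤ_[p]) ^ j * hu + hw

omit hp in
/-- What `alive … = false` means for a residue that does carry `F ≡ 0`: it is in a ball. -/
private theorem inBall_of_not_alive {l : List ℤ} {cert : List (ℤ × ℕ × ℕ)} {j : ℕ} {r : ℤ}
    (hF : (p : ℤ) ^ j ∣ evalList l r) (ha : alive p l cert j r = false) :
    ∃ e ∈ cert, e.2.1 + 1 ≤ j ∧ (p : ℤ) ^ (e.2.1 + 1) ∣ r - e.1 := by
  simp only [alive, Bool.and_eq_false_imp, beq_iff_eq, emod_eq_zero_iff_dvd', Bool.not_eq_false',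
    inBall, List.any_eq_true, Bool.and_eq_true, decide_eq_true_eq] at ha
  exact ha hF |>.imp fun e he => ⟨he.1, he.2.1, he.2.2⟩

/-- **Soundness of the tree search.** If `coverTree … fuel j fr = true` and every root `z` of `F`
outside all certified balls is `≡ r (mod p^j)` for some `r ∈ fr`, then every root of `F` lies in
a certified ball. [folklore] -/
theorem inBall_of_coverTree (l : List ℤ) (cert : List (ℤ × ℕ × ℕ)) :
    ∀ (fuel j : ℕ) (fr : List ℤ), coverTree p l cert fuel j fr = true →
      (∀ z : ℤ_[p], aeval z (ofList l) = 0 → (∀ e ∈ cert, ¬ InBallOf z e) →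
        ∃ r ∈ fr, ‖z - (r : ℤ_[p])‖ ≤ (p : ℝ) ^ (-(j : ℤ))) →
      ∀ z : ℤ_[p], aeval z (ofList l) = 0 → ∃ e ∈ cert, InBallOf z e := by
  intro fuel
  induction fuel with
  | zero =>
    intro j fr h hinv z hz
    by_contra hne
    push Not at hne
    obtain ⟨r, hr, -⟩ := hinv z hz hne
    simp only [coverTree, List.isEmpty_iff] at h
    rw [h] at hr; exact absurd hr (by simp)
  | succ fuel ih =>
    intro j fr h hinv z hz
    by_contra hne
    push Not at hne
    simp only [coverTree, Bool.or_eq_true, List.isEmpty_iff] at h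
    rcases h with h | h
    · obtain ⟨r, hr, -⟩ := hinv z hz hne
      rw [h] at hr; exact absurd hr (by simp)
    · refine absurd (ih (j + 1) _ h ?_ z hz) (by push Not; exact hne)
      -- the invariant one level up
      intro z' hz' hne'
      obtain ⟨r, hr, hzr⟩ := hinv z' hz' hne'
      obtain ⟨t, htp, hzt⟩ := exists_digit hzr
      refine ⟨r + (t : ℤ) * (p : ℤ) ^ j, ?_, hzt⟩
      -- the child is alive: `F ≡ 0 (mod p^{j+1})` there, and it is in no ball (else `z'` would be)
      have hF : (p : ℤ) ^ (j + 1) ∣ evalList l (r + (t : ℤ) * (p : ℤ) ^ j) := by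
        have h1 := padic_polynomial_dist (ofList l) (((r + (t : ℤ) * (p : ℤ) ^ j : ℤ)) : ℤ_[p]) z'
        rw [hz', sub_zero, aeval_intCast_ofList] at h1
        exact PadicInt.norm_int_le_pow_iff_dvd.mp
          (h1.trans (by rw [← norm_neg, neg_sub]; exact hzt))
      have halive : alive p l cert (j + 1) (r + (t : ℤ) * (p : ℤ) ^ j) = true := by
        by_contra ha
        rw [Bool.not_eq_true] at ha
        obtain ⟨e, he, hej, hdvd⟩ := inBall_of_not_alive hF ha
        apply hne' e he
        -- `‖z' - c‖ ≤ max (‖z' - r'‖, ‖r' - c‖) ≤ p^{-(m+1)}`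
        have hp1 : (1 : ℝ) ≤ p := by exact_mod_cast hp.out.one_lt.le
        have hrc : ‖(((r + (t : ℤ) * (p : ℤ) ^ j : ℤ)) : ℤ_[p]) - (e.1 : ℤ_[p])‖ ≤
            (p : ℝ) ^ (-((e.2.1 + 1 : ℕ) : ℤ)) := by
          rw [← Int.cast_sub]; exact norm_intCast_le_of_dvd hdvd
        unfold InBallOf
        calc ‖z' - (e.1 : ℤ_[p])‖
            = ‖(z' - (((r + (t : ℤ) * (p : ℤ) ^ j : ℤ)) : ℤ_[p])) +
                ((((r + (t : ℤ) * (p : ℤ) ^ j : ℤ)) : ℤ_[p]) - (e.1 : ℤ_[p]))‖ := by ring_nf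
          _ ≤ max ‖z' - (((r + (t : ℤ) * (p : ℤ) ^ j : ℤ)) : ℤ_[p])‖
                ‖(((r + (t : ℤ) * (p : ℤ) ^ j : ℤ)) : ℤ_[p]) - (e.1 : ℤ_[p])‖ :=
              PadicInt.nonarchimedean _ _
          _ ≤ (p : ℝ) ^ (-((e.2.1 + 1 : ℕ) : ℤ)) :=
              max_le (hzt.trans (zpow_le_zpow_right₀ hp1 (by push_cast; omega))) hrc
      exact List.mem_flatMap.mpr ⟨r, hr, List.mem_filter.mpr
        ⟨List.mem_map.mpr ⟨t, List.mem_range.mpr htp, rfl⟩, halive⟩⟩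

/-- What `coverOK` certifies: every root of `F` in `ℤ_p` lies in a certified ball. [folklore] -/
theorem inBall_of_coverOK {l : List ℤ} {k : ℕ} {cert : List (ℤ × ℕ × ℕ)}
    (h : coverOK p l k cert = true) (z : ℤ_[p]) (hz : aeval z (ofList l) = 0) :
    ∃ e ∈ cert, ‖z - (e.1 : ℤ_[p])‖ ≤ (p : ℝ) ^ (-((e.2.1 + 1 : ℕ) : ℤ)) :=
  inBall_of_coverTree l cert k 0 [0] h
    (fun z _ _ => ⟨0, List.mem_singleton.mpr rfl, by simpa using PadicInt.norm_le_one z⟩) z hz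

end Unpack

/-- Sanity check of the kernel evaluation: `X² − 7` has exactly the two roots `≡ ±1 (mod 3)` in
`ℤ₃` (certificate at precision `k = 1`). [folklore] -/
example : check 3 [-7, 0, 1] 1 [((1 : ℤ), 0, 1), (-1, 0, 1)] = true := by decide

end Summit.BirchSwinnertonDyer.Rank1Residual.GaloisImage.RootCensus
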